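import Mathlib
import HarnessLib
import HarnessLib.Audit
import Summits.AnomalousDissipation.Statement
import Literature.Analysis.FluidPDE.LerayHopf
import Literature.Analysis.FluidPDE.ZerothLaw
import Literature.Analysis.FluidPDE.DoeringFoias
import Literature.Analysis.FluidPDE.StokesTorus
import Literature.Analysis.FluidPDE.StokesTorusProofs
import HarnessLib.Audit.Status.Attr

/-!
Route: QuietRigidity

CLOSED (superseded) 2026-08-30T03:16:26Z by planner-decomp-ad-lens-4-g2-0 — reason: superseded:route-AnomalousDissipation-SymmetricOrLoud — superseded by route-AnomalousDissipation-SymmetricOrLoud — note: decomp-ad lens-4 generation 2: the critic graded QuietLawsAreSteady COSTUME (steady exemption empty in the bounded zero-momentum class at a gravest mode, census 15372 class); SymmetricOrLoud replaces the normal form by translation-symmetric states at the second-shell Kolmogorov force, where the exem. The file is kept as the record of this route; refuted decls are indexed as negative knowledge (`ledger negatives`).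

# Route QuietRigidity — quiet stationary statistics are steady; a bounded non-steady law then forces
the zeroth law

Root decomposition node (cell decomp-ad, lens «minimal counterexample», D-0178). Pin a gravest
Stokes-mode body force
f = stokesMode k a c on T³ (|k| = 1, k·a = 0, a ≠ 0; the Kolmogorov force is one). It suffices to
show X = X1 ∧ X2 ∧ X3:
X2 (QuietLawsAreSteady, RIGIDITY of the minimal counterexample): every stationary Leray–Hopf
trajectory law of NS_ν(f),
0 < ν ≤ 1, whose paths have zero momentum, mean energy ≤ E₀ and are QUIET in ratio form
(meanDissipation ≤ θ₀·meanEnergy,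
θ₀ = θ₀(f,E₀) > 0) is almost surely STEADY; X3 (NonSteadyBoundedLaws, declared residual): for some
gravest mode there are
ν_j → 0 and stationary bounded zero-momentum Leray–Hopf laws that are NOT a.s. steady; X1
(RatioUpgrade): the rate-per-energy
form of the zeroth law implies the audited one. Normal form N = steady states: quiet steady states
are exempted, not excluded.
Lean: `RatioUpgrade ∧ QuietLawsAreSteady ∧ NonSteadyBoundedLaws`

## Assembly
Pure logic (theorem closes in glue.lean): NonSteadyBoundedLaws gives the mode, E₀, ν_j and
non-steady laws P_j; QuietLawsAreSteady
at (mode, E₀) gives θ₀; since P_j satisfies every hypothesis of the rigidity except possibly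
quietness and is not a.s. steady, some
path of P_j has θ₀·meanEnergy < meanDissipation and is a global Leray–Hopf solution of NS_{ν_j}(f);
choice over j and the tree
lemmas isSmooth_stokesMode / isDivFree_stokesMode / hasZeroMean_stokesMode give the hypothesis of
RatioUpgrade, which concludes.

Rationale: WHY THIS LINE. Minimal-counterexample reduction: if loud bounded statistics fail at the pinned
force, order the would-be counterexamples —
stationary statistics with bounded energy — by the dissipation ratio D/E; the node asserts the
extremal (quietest) ones have a
normal form, namely steady states (a Liouville/rigidity statement in the spirit of
Koch–Nadirashvili–Seregin–Šverák for bounded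
ancient solutions, arXiv:0709.3599, Seregin doi:10.1088/0951-7715/29/8/2191, transplanted from
unforced mild solutions to forced
stationary statistics at small viscosity), and SIDESTEPS the normal form: the other piece only has
to supply a bounded law that is
not steady. Imported area: ergodic theory of stationary processes (the law format; Birkhoff, in tree
as
Literature.Dynamics.Ergodic.birkhoff_ergodic_theorem_holds, is what makes pathwise and ensemble
quietness interchangeable for a
prover) and dynamical-systems rigidity. What prior routes do not do: every floor in the tree is
either a ∀-floor over a symmetry
class (PumpedMirror, MirrorEnsemble — killed by quiet steady branches, census 15372,
Literature/Barriers/AnomalousDissipation/QuietRootFloorBarrier.lean)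
or a witness floor on steady states themselves (SteadyZerothLaw 0219, LambCircleTG,
TaylorCertificates); here steady states are the
EXEMPTED normal form and no realisation crux is needed (contrast Ensemble item 0215): pathwise
quietness makes the extraction of a
loud Leray–Hopf path five lines of logic (theorem closes). The ratio normal form discharges the
summit's energy-ceiling axis
(hard core GPMeanBoundedFamily) except where it is honest open content (the bounded-energy clause of
X3).

RANKED CRUXES. #2 QuietLawsAreSteady (crux) — for every gravest Stokes mode (k ≠ 0, ∑kᵢ² = 1, a ≠ 0,
k·a = 0) and every E₀ there is θ₀ > 0 such that for 0 < ν ≤ 1 every stationary Leray–Hopf trajectory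
law of NS_ν(stokesMode k a c) — standard Borel probability space (Ω,P), P-preserving S, paths traj
with traj (S ω) t = traj ω (t+1), weakly measurable in ω, EVERY path a global Leray–Hopf solution
with zero momentum, meanEnergy ≤ E₀ and meanDissipation ≤ θ₀·meanEnergy — is a.s. steady (traj ω t =
traj ω 0 a.e. on T³ for all t ≥ 0). [difficulty: open-problem] (why it might fail: a quiet bounded
zero-momentum time-periodic/quasi-periodic solution persisting as ν → 0 (a viscosity-selectable
smooth time-periodic solution of FORCED Euler with a gravest-mode force) refutes it; KAM
quasi-periodic Euler flows exist for tailored forces (arXiv:2003.14313).) [arXiv:0709.3599,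
doi:10.1088/0951-7715/29/8/2191, doi:10.1088/0169-5983/48/6/061425, doi:10.1063/1.869159,
Marchioro1986, arXiv:2003.14313]
#3 NonSteadyBoundedLaws (crux) — (declared RESIDUAL) for some gravest Stokes mode there are E₀,
viscosities 0 < ν_j ≤ 1 with ν_j → 0 and, for every j, a stationary Leray–Hopf trajectory law of
NS_{ν_j}(stokesMode k a c) in the format of QuietLawsAreSteady, all paths with zero momentum and
meanEnergy ≤ E₀, which is NOT almost surely steady — sustained, bounded, genuinely time-dependent
statistics survive the vanishing-viscosity limit; no dissipation floor is asked. [difficulty: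
open-problem] (why it might fail: the ν-uniform mean-energy bound at fixed force is the hard-core
energy axis (GPMeanBoundedFamily); it is false iff all six gravest modes laminarise at bounded
energy (every bounded zero-momentum stationary law steady for small ν).)
[ConstantinTarfuleaVicol2013, DoeringFoias2002, doi:10.1103/physreve.89.023004,
doi:10.1088/0169-5983/48/6/061425, FoiasManleyRosaTemam2001]
#4 RatioUpgrade (crux) — the rate-per-energy form of the zeroth law (some smooth divergence-free
mean-zero steady force, some θ > 0, ν_j → 0, global Leray–Hopf solutions with θ·meanEnergy(u_j) <
meanDissipation(ν_j,u_j)) implies AnomalousDissipation: the energy bound comes from meanDissipation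
≤ ‖f‖₂·√meanEnergy, the floor from the Doering–Foias amplitude bound (meanEnergy ≥ c(f) > 0 for ν ≤
1, f ≠ 0 being forced by the strict ratio inequality). [difficulty: M] (why it might fail: only via
limsup junk values (meanEnergy/meanDissipation default to 0 for unbounded Cesàro means), excluded at
fixed ν > 0 by Torus.IsGlobalLerayHopf.timeMean_norm_sq_le; the j-uniform floor needs the amplitude
bound for a general smooth force (shape f/‖f‖₂, n = 1).) [DoeringFoias2002,
CheskidovDoeringPetrov2006, Frisch1995]

TWO-LAYER PLAN. QuietLawsAreSteady ⇐ (QuietEmptyAboveThreshold: for ν > θ₀/4π² the hypothesis class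
is empty — Poincaré at zero momentum plus the
Doering–Foias energy floor; provable now) → (QuietRigiditySmallViscosity: the statement for ν ≤
θ₀/4π²) → QuietLawsAreSteady.
NonSteadyBoundedLaws ⇐ (BoundedStationaryLaws: bounded zero-momentum stationary LH laws exist along
ν_j → 0 — the energy axis) →
(NoLaminarisation: such laws can be chosen not a.s. steady) → NonSteadyBoundedLaws. Ensemble-average
variants (E(P), D(P) in place of
pathwise bounds) are interchangeable for ergodic laws by Birkhoff (in tree) — a prover may restate
children in that form.

KILL CRITERIA. Refutation of QuietLawsAreSteady by an explicit quiet, bounded, zero-momentum,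
non-steady stationary law at a gravest mode
(e.g. a time-periodic solution family with ν‖∇u‖² → 0) closes the route (close --reason
refuted:QuietLawsAreSteady) AND is a new
barrier entry (periodic analogue of QuietRootFloorBarrier). Refutation of NonSteadyBoundedLaws
(laminarisation at bounded energy at
all six gravest modes) closes the route and kills every pinned-gravest-mode line of the summit. A
proof elsewhere of the zeroth law
at any force moots the route; a proof of GPMeanBoundedFamily-type energy bounds reduces
NonSteadyBoundedLaws to NoLaminarisation.

NOT DECOMPOSED YET. The measurability format of a «stationary Leray–Hopf trajectory law» is inlined
(standard Borel Ω, measure-preserving S,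
intertwining, weakly measurable pairings); a named structure (definition request below) would
shorten both law pieces. The finite
Galerkin analogue of QuietLawsAreSteady (test T1) and the 2D/2½D laminarisation sub-cases
(Marchioro1986,
Literature/Barriers/AnomalousDissipation/GravestModeLaminarAttractor.lean) are layer-2 children, not
filed now. Constants θ₀, E₀ are
not optimised.

CHEAPEST FALSIFIER. T1 (instrument request filed on the cell bus): continue periodic orbits of the
zero-momentum Galerkin truncations P_N NS_ν(f_K),
f_K = sin(2πx₂)e₁, N = 2,3,4 shells, down to ν → 0; a branch with bounded energy and ν‖∇u‖² → 0 is
the finite-dimensional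
refutation pattern of QuietLawsAreSteady (not yet a PDE refutation, but it retags the crux BARRIER).
T2: tabulate D/E against Re
for the recurrent solutions of 3D Kolmogorov flow in doi:10.1088/0169-5983/48/6/061425 and
doi:10.1063/1.869159; a family with
D/E → 0 kills the crux. Not run here (kit not allowed for this seat).

NUMBERS. Poincaré at zero momentum on the unit torus: meanDissipation ≥ 4π²ν·meanEnergy, so the
quiet class is empty for ν > θ₀/4π².
Doering–Foias: meanDissipation ≤ ‖f‖₂ √meanEnergy (CheskidovDoeringPetrov2006 eq. (17)); amplitude
bound |F| ≤ a U²/ℓ + b ν U/ℓ²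
(DoeringFoias2002 §3, in tree as DoeringFoias2002_amplitude_le_holds).

DEFINITION REQUESTS. Notion wanted (not blocking):
`Literature.Analysis.FluidPDE.Torus.IsStationaryLerayHopfLaw ν f Ω P S traj` bundling
measure-preservation, intertwining traj (S ω) t = traj ω (t+1), weak measurability of pairings and
the everywhere-Leray–Hopf path
condition (topic Literature/Analysis/FluidPDE); to be filed with `ledger workitem add --kind
definition` once the route is open.

Novelty: Searches (2026-08-30): lit search "Kolmogorov flow three dimensions transition periodic chaotic" (8
local, 8 remote: doi:10.1063/1.869159, doi:10.1088/0169-5983/48/6/061425, doi:10.1063/1.4917279);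
lit search "Liouville theorem Navier-Stokes bounded ancient solutions Koch Nadirashvili Seregin
Sverak" (6 local, 6 remote: arXiv:0709.3599, doi:10.1088/0951-7715/29/8/2191); lit galaxy search
"time-periodic Euler|quiet turbulence|laminar to turbulent transition in Kolmogorov flow" --star all
(12 rows, none relevant); lit galaxy search "quasi-periodic incompressible Euler|…" --star pdf (1
hit: galaxy:pdf:-5060323963487679640 = arXiv:2408.16671); tree: rg over 29 Theses files of the
summit for «steady»/«Steady» conclusions (none conclude steadiness;
SteadyZerothLaw/SteadyWeakRealisation/LambCircleTG use steady states as witnesses); ledger negatives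
--problem AnomalousDissipation (13037, 14324, 0204, 2979, 2984, 2859 — none a rigidity statement).
Nearest prior art found: arXiv:0709.3599 (KNSS Liouville theorems: bounded ancient mild solutions of
unforced NS are constant in 2D / axisymmetric-no-swirl) and
Literature/Barriers/AnomalousDissipation/QuietRootFloorBarrier.lean (quiet steady Galerkin branches
cap every floor over all invariant measures).
Delta: the rigidity is asked of forced, stationary STATISTICS at small viscosity and concludes
steadiness (not constancy), and the decomposition exempts the steady normal form instead of bounding
it — the floor is asked only of non-steady l  [refs: 10.1063/1.869159, 10.1088/0169-5983/48/6/061425, 10.1063/1.4917279, 10.1088/0951-7715/29/8/2191, 0709.3599, 2408.16671, doi:10.1063/1.869159, doi:10.1088/0169-5983/48/6/061425, doi:10.1063/1.4917279, doi:10.1088/0951-7715/29/8/2191]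

Barriers (technique_class: ergodic-rigidity, liouville, statistical-solutions): - technique_class: ergodic-rigidity, liouville, statistical-solutions
- Literature.Barriers.AnomalousDissipation.AlexakisDoering2006_energyDissipationBound: outside — 2D
and 2½D sub-dynamics of a gravest mode laminarise (Marchioro1986; tree:
Literature/Barriers/AnomalousDissipation/GravestModeLaminarAttractor.lean,
Marchioro1986_globalAttraction), so quiet 2D statistics (ε → 0 by this bound) cannot populate the
hypothesis class of QuietLawsAreSteady at bounded energy and zero momentum; for second-shell planar
forces they could, which is why the force is pinned to the gravest shell.
- Literature.Barriers.AnomalousDissipation.BrueDeLellis2023_noAnomaly_beforeEulerSingularity: it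
does not bite the statements (infinite-time stationary statistics, not a finite window before the
first Euler singularity); the bet of QuietLawsAreSteady is that no smooth time-periodic forced-Euler
state with a gravest-mode force is viscosity-selectable as a stationary law. The finite-dimensional
cousin Literature/Barriers/AnomalousDissipation/QuietRootFloorBarrier.lean (quiet steady Galerkin
branches cap every floor valid at all steady states) is evaded by construction: QuietLawsAreSteady
exempts steady states (its conclusion IS steadiness) and NonSteadyBoundedLaws asks no floor.
- Literature.Barriers.AnomalousDissipation.BardosTitiWiedemann2012_thm5: outside —
viscosity-selected shear flows are unforced and x₃-sheared 2½D states; zero momentum, the pinned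
steady force and stationarity exclude them fr

History (route lifecycle, newest last):
- 2026-08-30T03:16:26Z · CLOSED superseded — superseded:route-AnomalousDissipation-SymmetricOrLoud (planner-decomp-ad-lens-4-g2-0)

sub-problem: AnomalousDissipation · status: closed(superseded) · opened planner-decomp-ad-lens-4-g0-0 2026-08-30T01:31:41Z · rev 0 · ledger route-AnomalousDissipation-QuietRigidity
GENERATED by the gate from the ledger (D-0016/17). Provers cite these decls: `theorem foo : Summit.AnomalousDissipation.AnomalousDissipation.Theses.QuietRigidity.<Decl> := …` in Summits/AnomalousDissipation/AnomalousDissipation/Theorems/<Name>.lean.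
-/

namespace Summit.AnomalousDissipation.AnomalousDissipation.Theses.QuietRigidity

open scoped BigOperators Topology Manifold Classical MeasureTheory ProbabilityTheory Matrix InnerProductSpace ComplexConjugate ContinuousMap
open Filter Set Function TopologicalSpace MeasureTheory

attribute [summit_statement] _root_.AnomalousDissipation

open Literature.Turb

/-- item stmt-AnomalousDissipation-23803 · crux · rank 2 · closed · moot by None · by planner
why it might fail: a quiet bounded zero-momentum time-periodic/quasi-periodic solution persisting as ν → 0 (a viscosity-selectable smooth time-periodic solution of FORCED Euler with a gravest-mode force) refutes it; KAM quasi-periodic Euler flows exist for tailored forces (arXiv:2003.14313).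
sources: arXiv:0709.3599, doi:10.1088/0951-7715/29/8/2191, doi:10.1088/0169-5983/48/6/061425, doi:10.1063/1.869159, Marchioro1986, arXiv:2003.14313
[crux] for every gravest Stokes mode (k ≠ 0, ∑kᵢ² = 1, a ≠ 0, k·a = 0) and every E₀ there is θ₀ > 0
such that for 0 < ν ≤ 1 every stationary Leray–Hopf trajectory law of NS_ν(stokesMode k a c) —
standard Borel probability space (Ω,P), P-preserving S, paths traj with traj (S ω) t = traj ω (t+1),
weakly measurable in ω, EVERY path a global Leray–Hopf solution with zero momentum, meanEnergy ≤ E₀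
and meanDissipation ≤ θ₀·meanEnergy — is a.s. steady (traj ω t = traj ω 0 a.e. on T³ for all t ≥ 0).
[difficulty: open-problem] -/
@[route_item "route-AnomalousDissipation-QuietRigidity", crux]
def QuietLawsAreSteady : Prop :=
  ∀ (k : Fin 3 → ℤ) (a : EuclideanSpace ℝ (Fin 3)) (c : Bool), k ≠ 0 → ∑ i, (k i) ^ 2 = 1 → a ≠ 0 → inner ℝ (Literature.Analysis.FunctionSpaces.Torus.latticeVec k) a = 0 → ∀ E₀ : ℝ, ∃ θ₀ : ℝ, 0 < θ₀ ∧ ∀ ν : ℝ, 0 < ν → ν ≤ 1 → ∀ (Ω : Type) [MeasurableSpace Ω] [StandardBorelSpace Ω] (P : MeasureTheory.Measure Ω) [MeasureTheory.IsProbabilityMeasure P] (S : Ω → Ω) (traj : Ω → ℝ → UnitAddTorus (Fin 3) → EuclideanSpace ℝ (Fin 3)), MeasureTheory.MeasurePreserving S P P → (∀ ω t, traj (S ω) t = traj ω (t + 1)) → (∀ (t : ℝ) (g : UnitAddTorus (Fin 3) → EuclideanSpace ℝ (Fin 3)), MeasureTheory.MemLp g 2 MeasureTheory.volume → Measurable fun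 ω => ∫ x, inner ℝ (traj ω t x) (g x)) → (∀ ω, Literature.Analysis.FluidPDE.Torus.IsGlobalLerayHopf ν (fun _ => ⇑(Literature.Analysis.FluidPDE.Torus.stokesMode k a c)) (traj ω 0) (traj ω)) → (∀ ω t, 0 ≤ t → Literature.Analysis.FunctionSpaces.Torus.HasZeroMean (traj ω t)) → (∀ ω, Literature.Analysis.FluidPDE.meanEnergy (traj ω) ≤ E₀) → (∀ ω, Literature.Analysis.FluidPDE.meanDissipation ν (traj ω) ≤ θ₀ * Literature.Analysis.FluidPDE.meanEnergy (traj ω)) → ∀ᵐ ω ∂P, ∀ t : ℝ, 0 ≤ t → traj ω t =ᵐ[MeasureTheory.volume] traj ω 0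

/-- item stmt-AnomalousDissipation-23804 · crux · rank 3 · closed · moot by None · by planner
why it might fail: the ν-uniform mean-energy bound at fixed force is the hard-core energy axis (GPMeanBoundedFamily); it is false iff all six gravest modes laminarise at bounded energy (every bounded zero-momentum stationary law steady for small ν).
sources: ConstantinTarfuleaVicol2013, DoeringFoias2002, doi:10.1103/physreve.89.023004, doi:10.1088/0169-5983/48/6/061425, FoiasManleyRosaTemam2001
[crux] (declared RESIDUAL) for some gravest Stokes mode there are E₀, viscosities 0 < ν_j ≤ 1 with
ν_j → 0 and, for every j, a stationary Leray–Hopf trajectory law of NS_{ν_j}(stokesMode k a c) in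
the format of QuietLawsAreSteady, all paths with zero momentum and meanEnergy ≤ E₀, which is NOT
almost surely steady — sustained, bounded, genuinely time-dependent statistics survive the
vanishing-viscosity limit; no dissipation floor is asked. [difficulty: open-problem] -/
@[route_item "route-AnomalousDissipation-QuietRigidity", crux]
def NonSteadyBoundedLaws : Prop :=
  ∃ (k : Fin 3 → ℤ) (a : EuclideanSpace ℝ (Fin 3)) (c : Bool), k ≠ 0 ∧ ∑ i, (k i) ^ 2 = 1 ∧ a ≠ 0 ∧ inner ℝ (Literature.Analysis.FunctionSpaces.Torus.latticeVec k) a = 0 ∧ ∃ (E₀ : ℝ) (ν : ℕ → ℝ), (∀ j, 0 < ν j) ∧ (∀ j, ν j ≤ 1) ∧ Filter.Tendsto ν Filter.atTop (nhds 0) ∧ ∀ j, ∃ (Ω : Type) (_ : MeasurableSpace Ω) (_ : StandardBorelSpace Ω) (P : MeasureTheory.Measure Ω) (_ : MeasureTheory.IsProbabilityMeasure P) (S : Ω → Ω) (traj : Ω → ℝ → UnitAddTorus (Fin 3) → EuclideanSpace ℝ (Fin 3)), MeasureTheory.MeasurePreserving S P P ∧ (∀ ω t, traj (S ω) t = traj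 ω (t + 1)) ∧ (∀ (t : ℝ) (g : UnitAddTorus (Fin 3) → EuclideanSpace ℝ (Fin 3)), MeasureTheory.MemLp g 2 MeasureTheory.volume → Measurable fun ω => ∫ x, inner ℝ (traj ω t x) (g x)) ∧ (∀ ω, Literature.Analysis.FluidPDE.Torus.IsGlobalLerayHopf (ν j) (fun _ => ⇑(Literature.Analysis.FluidPDE.Torus.stokesMode k a c)) (traj ω 0) (traj ω)) ∧ (∀ ω t, 0 ≤ t → Literature.Analysis.FunctionSpaces.Torus.HasZeroMean (traj ω t)) ∧ (∀ ω, Literature.Analysis.FluidPDE.meanEnergy (traj ω) ≤ E₀) ∧ ¬ (∀ᵐ ω ∂P, ∀ t : ℝ, 0 ≤ t → traj ω t =ᵐ[MeasureTheory.volume] traj ω 0)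

/-- item stmt-AnomalousDissipation-23805 · crux · rank 4 · open · by planner
why it might fail: only via limsup junk values (meanEnergy/meanDissipation default to 0 for unbounded Cesàro means), excluded at fixed ν > 0 by Torus.IsGlobalLerayHopf.timeMean_norm_sq_le; the j-uniform floor needs the amplitude bound for a general smooth force (shape f/‖f‖₂, n = 1).
sources: DoeringFoias2002, CheskidovDoeringPetrov2006, Frisch1995
[crux] the rate-per-energy form of the zeroth law (some smooth divergence-free mean-zero steady
force, some θ > 0, ν_j → 0, global Leray–Hopf solutions with θ·meanEnergy(u_j) <
meanDissipation(ν_j,u_j)) implies AnomalousDissipation: the energy bound comes from meanDissipation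
≤ ‖f‖₂·√meanEnergy, the floor from the Doering–Foias amplitude bound (meanEnergy ≥ c(f) > 0 for ν ≤
1, f ≠ 0 being forced by the strict ratio inequality). [difficulty: M] -/
@[route_item "route-AnomalousDissipation-QuietRigidity", crux]
def RatioUpgrade : Prop :=
  (∃ f : UnitAddTorus (Fin 3) → EuclideanSpace ℝ (Fin 3), Literature.Analysis.FunctionSpaces.Torus.IsSmooth f ∧ Literature.Analysis.FunctionSpaces.Torus.IsDivFree f ∧ Literature.Analysis.FunctionSpaces.Torus.HasZeroMean f ∧ ∃ θ : ℝ, 0 < θ ∧ ∃ (ν : ℕ → ℝ) (u₀ : ℕ → UnitAddTorus (Fin 3) → EuclideanSpace ℝ (Fin 3)) (u : ℕ → ℝ → UnitAddTorus (Fin 3) → EuclideanSpace ℝ (Fin 3)), (∀ j, 0 < ν j) ∧ Filter.Tendsto ν Filter.atTop (nhds 0) ∧ (∀ j, Literature.Analysis.FluidPDE.Torus.IsGlobalLerayHopf (ν j) (fun _ => f) (u₀ j) (u j)) ∧ ∀ j, θ * Literature.Analysis.FluidPDE.meanEnergy (u j) < Literature.Analysis.FluidPDE.meanDissipation (ν j)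 (u j)) → _root_.AnomalousDissipation

/-- item stmt-AnomalousDissipation-23806 · assembly · rank 1 · closed · moot by None · by planner
sources: DoeringFoias2002, arXiv:0709.3599
[assembly] RatioUpgrade → QuietLawsAreSteady → NonSteadyBoundedLaws → the zeroth law (literally
theorem closes). -/
@[route_item "route-AnomalousDissipation-QuietRigidity"]
def Assembly : Prop :=
  RatioUpgrade → QuietLawsAreSteady → NonSteadyBoundedLaws → _root_.AnomalousDissipation

/-! D-0027 §2.1 — DECIDING THEOREM (planner-authored via `route open/edit --closes-file`; by planner-decomp-ad-lens-4-g0-0 2026-08-30T01:31:41Z) — ARCHIVED: route closed (superseded) 2026-08-30T03:16:26Z; kept so importers keep building: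
its hypotheses are this route's items and its conclusion the sub-problem Statement (glue_lint), and it elaborates with this file. -/

@[closes "route-AnomalousDissipation-QuietRigidity"] theorem closes (h₁ : RatioUpgrade) (h₂ : QuietLawsAreSteady) (h₃ : NonSteadyBoundedLaws) :
    _root_.AnomalousDissipation := by
  apply h₁
  obtain ⟨k, a, c, hk, hk1, ha, hka, E₀, ν, hν, hν1, hν0, hlaw⟩ := h₃
  obtain ⟨θ₀, hθ₀, hrig⟩ := h₂ k a c hk hk1 ha hka E₀
  have key : ∀ j, ∃ (u₀ : UnitAddTorus (Fin 3) → EuclideanSpace ℝ (Fin 3))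
      (u : ℝ → UnitAddTorus (Fin 3) → EuclideanSpace ℝ (Fin 3)),
      Literature.Analysis.FluidPDE.Torus.IsGlobalLerayHopf (ν j)
          (fun _ => ⇑(Literature.Analysis.FluidPDE.Torus.stokesMode k a c)) u₀ u ∧
        θ₀ * Literature.Analysis.FluidPDE.meanEnergy u <
          Literature.Analysis.FluidPDE.meanDissipation (ν j) u := by
    intro j
    obtain ⟨Ω, mΩ, sΩ, P, hP, S, traj, hS, hshift, hmeas, hLH, hzm, hE, hns⟩ := hlaw j
    by_contra hcon
    push_neg at hcon
    exact hns (hrig (ν j) (hν j) (hν1 j) Ω P S traj hS hshift hmeas hLH hzm hE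
      (fun ω => hcon (traj ω 0) (traj ω) (hLH ω)))
  choose u₀ u hu using key
  exact ⟨⇑(Literature.Analysis.FluidPDE.Torus.stokesMode k a c),
    Literature.Analysis.FluidPDE.Torus.isSmooth_stokesMode k a c,
    Literature.Analysis.FluidPDE.Torus.isDivFree_stokesMode hka c,
    Literature.Analysis.FluidPDE.Torus.hasZeroMean_stokesMode hk a c,
    θ₀, hθ₀, ν, u₀, u, hν, hν0, fun j => (hu j).1, fun j => (hu j).2⟩

end Summit.AnomalousDissipation.AnomalousDissipation.Theses.QuietRigidity
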